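import Summits.ResolutionOfSingularities.ResolutionOfSingularities.Theorems.PurelyInseparableDim4ParamLiftSources
import Summits.ResolutionOfSingularities.ResolutionOfSingularities.Theorems.PurelyInseparableDim4UniformLocalCert
import Summits.ResolutionOfSingularities.ResolutionOfSingularities.Theorems.PurelyInseparableDim4WinCertAllFieldsScope
import Summits.ResolutionOfSingularities.ResolutionOfSingularities.Theorems.PurelyInseparableDim4DivClock
import HarnessLib

/-!
# [OURS · res-dim4-pi · F4-C-loc] PARAMETRIC UNIFORM LOCAL WIN CERTIFICATES (format v3): rows are one-letter FAMILIES
  of states, charts are FORCING CHAINS with four endings, blind rows exit the scope — checked by `decide`, sound over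
  EVERY field of the characteristic and every value `β ≠ 0` of B's letter

Cell `res-dim4-pi` (D-0157 DOOR 2, wave 2), seat `res-dim4-p-6` g3; built on `…ParamLift` / `…ParamLiftSources`
(five-letter term lists, `spec f β`) and the seat's v1/v2 formats (`…UniformLocalCert`, `…HopRegionsLocalCertUniform`).
This is the format the two ROOTS `d0` (LOOP-D) and `fc3` (F3) need (their tables follow in `…ParamCertLoopD`).

* **rows** `(L, cert)`: `L : Terms 5 k` presents the family `spec f β (evalT L)`, `β ∈ K ∖ {0}` (t-free rows are
  the rational states, any `β`); `cert` is `blind c w α₀ a` (t-free row; `ScopeBlind.blindB` monomial-curve certificate,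
  lifted by res-dim4-p-14's `WinCertAllFields.not_inCoordinateScope_map_of_blindB`: the family is OUT OF COORDINATE
  SCOPE, a terminal position of the in-scope game) or `move S charts` (A plays `V(x_S)`, `ppermB`).
* **charts** `(steps, ending)` for `j ∈ S`, read against `G = chartL q (S5 S) j.castSucc L` with the free fibre
  coordinates `U := S ∖ {j}` shrinking along the chain: a step `(γ, i)` is a FORCING check `pforceB q U G γ i`
  (an equimultiple `K`-point over the current point has `bᵢ = 0`; continue with `U ∖ {i}`); the endings:
  `dead γ` (`pwitB`: no equimultiple point with the remaining freedom at all), `child` (`U = ∅`: the reply is the chart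
  origin; its child `clean4 q G` is `0` or a LATER ROW), `free i` (`U = {i}`, `G` t-free: the reply is `β'·δᵢ`, `β'`
  arbitrary — `β' = 0` gives the origin child, `β' ≠ 0` gives the LETTER child `clean4 q (shearL i G)`, a later row
  read at `β'`), `root γ i ρ` (`U = {i}`, `prootB` on `G` or on `G.reverse` — the two sources in either order: the reply is the
  origin or the RATIONAL point `f ρ·δᵢ`, child
  `clean4 q (transVar i.castSucc ρ G)` a later row).
* **`pcertB q T`** (the checker) and **`pwin_of_pcertB`** (soundness): for every row `L` of a checked table, for
  every `β ≠ 0` and EVERY bookkeeping `(r, exc)`, the state `⟨spec f β (evalT L), r, exc⟩` is an A-win of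
  the LOCAL in-scope game `LoopCLocal.RWins q localB` over `K`; **`rWins_liftState_of_pcertB`**: a presented `𝔽₃`
  state whose `embed` heads a checked table is a local A-win over every field of characteristic `3`.

Design notes (honest): soundness never uses an algebraic relation on `β` (only `β ≠ 0`), nor the multiplicities —
`r`/`exc` are quantified away, so rows need not track them; scope is handled as in v1 (an out-of-scope position is won
outright, so a `move` row may pretend scope).  [OURS · counted 0 · certificate format + soundness; AI kernel work,
weaker than expert review.]  NOTHING here is a statement about resolution of singularities; resolution in dimension
`≥ 4` / characteristic `p > 0` is NOT proved by anything in this file.  bears_on: LADDER-RESOLUTION:D157-DOOR2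
(res-dim4-pi · F4-C-loc all fields · parametric rows).  Host item (DR-157-C): `stmt-ResolutionOfSingularities-16155`,
helper.
-/

set_option linter.dupNamespace false -- mandated namespace of this single-conjunct summit

noncomputable section

open MvPolynomial Finset
open scoped BigOperators

namespace Summit.ResolutionOfSingularities.ResolutionOfSingularities.Theorems.PIDim4

namespace LoopCLocal

open Literature.AlgebraicGeometry.Resolution
open Literature.AlgebraicGeometry.Resolution.Hauser2010
open Literature.AlgebraicGeometry.Resolution.CentreBlowup
open StepKit ParamLift

section Format

variable {k : Type} [Field k] [DecidableEq k]

/-! ## §1 The format -/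

/-- the ending of a chart's forcing chain. OURS. [folklore] -/
inductive PEnd (k : Type) : Type
  /-- no equimultiple point remains: witness `γ` -/
  | dead (γ : Fin 4 → ℕ)
  /-- all fibre coordinates forced: the origin child is `0` or a later row -/
  | child
  /-- one free fibre coordinate `i` left, no constraint: origin child and letter child are later rows -/
  | free (i : Fin 4)
  /-- one fibre coordinate `i` left, pinned to `{0, ρ}` by the two-source check on `γ` -/
  | root (γ : Fin 4 → ℕ) (i : Fin 4) (ρ : k)

/-- a chart certificate: forcing steps `(γ, i)` and an ending. OURS. [folklore] -/
abbrev PChart (k : Type) : Type := List ((Fin 4 → ℕ) × Fin 4) × PEnd k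

/-- a row certificate: blind (out of scope) or a move with chart certificates. OURS. [folklore] -/
inductive PRowCert (k : Type) : Type
  /-- t-free row outside the coordinate scope: monomial-curve certificate data for `ScopeBlind.blindB` -/
  | blind (c : Fin 4 → k) (w : Fin 4 → ℕ) (α₀ : Fin 4 → ℕ) (a : Fin 4 → k)
  /-- A plays `V(x_S)`; a chart certificate for every `j ∈ S` -/
  | move (S : Finset (Fin 4)) (charts : Fin 4 → PChart k)

/-- a row: a five-letter term list and its certificate. OURS. [folklore] -/
abbrev PRow (k : Type) : Type := Terms 5 k × PRowCert k

/-- `L` presents the same polynomial as some LATER row. OURS. [folklore] -/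
def memRowB (L : Terms 5 k) (rest : List (PRow k)) : Bool := rest.any fun r => StepKit.equivB L r.1

/-- a child is fine if it is `0` or a later row. OURS. [folklore] -/
def pchildB (L : Terms 5 k) (rest : List (PRow k)) : Bool := StepKit.equivB L [] || memRowB L rest

/-- the check of a forcing chain against the chart data `G`, free coordinates `U`. OURS. [folklore] -/
def pstepsB (q : ℕ) (rest : List (PRow k)) (G : Terms 5 k) :
    Finset (Fin 4) → List ((Fin 4 → ℕ) × Fin 4) → PEnd k → Bool
  | U, [], PEnd.dead γ => pwitB q U G γ
  | U, [], PEnd.child => decide (U = ∅) && pchildB (clean4 q G) rest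
  | U, [], PEnd.free i => decide (U = {i}) && tfreeB G && pchildB (clean4 q G) rest &&
      memRowB (clean4 q (shearL i G)) rest
  | U, [], PEnd.root γ i ρ => decide (U = {i}) && (prootB q U G γ i ρ || prootB q U G.reverse γ i ρ) &&
      pchildB (clean4 q G) rest && memRowB (clean4 q (transVar i.castSucc ρ G)) rest
  | U, (γ, i) :: steps, e => pforceB q U G γ i && pstepsB q rest G (U.erase i) steps e

/-- the row check. OURS. [folklore] -/
def prowB (q : ℕ) (rest : List (PRow k)) : PRow k → Bool
  | (L, PRowCert.blind c w α₀ a) => tfreeB L && ScopeBlind.blindB q (⟨trunc L, 0, ∅⟩ : SData 4 k) c w α₀ a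
  | (L, PRowCert.move S ch) => ppermB q S L &&
      decide (∀ j ∈ S, pstepsB q rest (chartL q (S5 S) j.castSucc L) (S.erase j) (ch j).1 (ch j).2 = true)

/-- **the parametric certificate checker**: rows in order, children later. OURS. [folklore] -/
def pcertB (q : ℕ) : List (PRow k) → Bool
  | [] => true
  | row :: rest => prowB q rest row && pcertB q rest

end Format

/-! ## §2 Soundness -/

section Sound

variable {k K : Type} [Field k] [Field K] [DecidableEq k] [DecidableEq K] (f : k →+* K)

/-- a later row presenting the same polynomial certifies it (for every `β ≠ 0` and every bookkeeping).
OURS. [folklore] -/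
theorem pwin_of_memRowB {q : ℕ} {rest : List (PRow k)}
    (hrest : ∀ row ∈ rest, (∀ β : K, β ≠ 0 → ∀ (r : Fin 4 →₀ ℕ) (exc : Finset (Fin 4)),
      RWins q localB (⟨spec f β (evalT row.1), r, exc⟩ : State K))) {L : Terms 5 k}
    (h : memRowB L rest = true) :
    (∀ β : K, β ≠ 0 → ∀ (r : Fin 4 →₀ ℕ) (exc : Finset (Fin 4)),
      RWins q localB (⟨spec f β (evalT L), r, exc⟩ : State K)) := by
  obtain ⟨r, hr, hrc⟩ := List.any_eq_true.mp h
  intro β hβ rr exc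
  rw [(evalT_eq_iff_equivB _ _).mpr hrc]
  exact hrest r hr β hβ rr exc

omit [DecidableEq k] [Field K] [DecidableEq K] in
/-- a reversed term list presents the same polynomial (the root check may read the two sources in either order).
OURS. [folklore] -/
theorem evalT_reverse (L : Terms 5 k) : evalT L.reverse = evalT L := by
  rw [evalT_eq_sum, evalT_eq_sum, List.map_reverse, List.sum_reverse]

omit [DecidableEq K] in
/-- a point vanishing off `{i}` is `bᵢ·δᵢ`. OURS. [folklore] -/
theorem eq_single_of_vanish {i : Fin 4} {b : Fin 4 → K} (hb : ∀ m : Fin 4, m ∉ ({i} : Finset (Fin 4)) → b m = 0) :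
    b = Pi.single i (b i) := by
  funext m
  by_cases hm : m = i
  · rw [hm, Pi.single_eq_same]
  · rw [Pi.single_eq_of_ne hm, hb m (by rwa [Finset.mem_singleton])]

omit [DecidableEq K] in
/-- a point vanishing off `∅` is `0`. OURS. [folklore] -/
theorem eq_zero_of_vanish {b : Fin 4 → K} (hb : ∀ m : Fin 4, m ∉ (∅ : Finset (Fin 4)) → b m = 0) : b = 0 :=
  funext fun m => hb m (Finset.notMem_empty m)

/-- **the origin child**: if `clean4 q G` is `0` or a later row, the step at `b = 0` is won (or impossible).
OURS. [folklore] -/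
theorem rWins_step_zero {q : ℕ} {rest : List (PRow k)} (hrest : ∀ row ∈ rest, (∀ β : K, β ≠ 0 → ∀ (r : Fin 4 →₀ ℕ) (exc : Finset (Fin 4)),
      RWins q localB (⟨spec f β (evalT row.1), r, exc⟩ : State K))) {β : K} (hβ : β ≠ 0)
    {L G : Terms 5 k} {S : Finset (Fin 4)} {j : Fin 4} (hG : G = chartL q (S5 S) j.castSucc L)
    (hchild : pchildB (clean4 q G) rest = true) (r : Fin 4 →₀ ℕ) (exc : Finset (Fin 4))
    (hne : (CentreBlowup.step q S j (0 : Fin 4 → K) (⟨spec f β (evalT L), r, exc⟩ : State K)).F ≠ 0) :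
    RWins q localB (CentreBlowup.step q S j (0 : Fin 4 → K) (⟨spec f β (evalT L), r, exc⟩ : State K)) := by
  set s' := CentreBlowup.step q S j (0 : Fin 4 → K) (⟨spec f β (evalT L), r, exc⟩ : State K) with hs'
  have hF : s'.F = spec f β (evalT (clean4 q G)) := by
    rw [hs', DivClock.step_F_eq, PointBlowup.translate_zero, chartTransform_spec, ← hG, deletePthPowers_spec]
  unfold pchildB at hchild
  rw [Bool.or_eq_true] at hchild
  rcases hchild with hzero | hmem
  · exfalso; apply hne
    rw [hF, (evalT_eq_zero_iff _).mpr hzero, map_zero]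
  · have hw : RWins q localB (⟨spec f β (evalT (clean4 q G)), s'.r, s'.exc⟩ : State K) :=
      pwin_of_memRowB f hrest hmem β hβ s'.r s'.exc
    rw [← hF] at hw
    exact hw

/-- **soundness of a chart's forcing chain**: every equimultiple reply `b` vanishing off `U` in the chart `j` leads to
a won position (or is impossible). OURS. [folklore] -/
theorem rWins_step_of_pstepsB {q : ℕ} {rest : List (PRow k)} (hrest : ∀ row ∈ rest, (∀ β : K, β ≠ 0 → ∀ (r : Fin 4 →₀ ℕ) (exc : Finset (Fin 4)),
      RWins q localB (⟨spec f β (evalT row.1), r, exc⟩ : State K))) {β : K}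
    (hβ : β ≠ 0) {L : Terms 5 k} {S : Finset (Fin 4)} {j : Fin 4} (r : Fin 4 →₀ ℕ) (exc : Finset (Fin 4)) :
    ∀ (steps : List ((Fin 4 → ℕ) × Fin 4)) (U : Finset (Fin 4)) (e : PEnd k),
      pstepsB q rest (chartL q (S5 S) j.castSucc L) U steps e = true →
      ∀ b : Fin 4 → K, (∀ m : Fin 4, m ∉ U → b m = 0) →
        IsEquimultiplePoint q S j b (⟨spec f β (evalT L), r, exc⟩ : State K) →
        (CentreBlowup.step q S j b (⟨spec f β (evalT L), r, exc⟩ : State K)).F ≠ 0 →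
        RWins q localB (CentreBlowup.step q S j b (⟨spec f β (evalT L), r, exc⟩ : State K)) := by
  set G := chartL q (S5 S) j.castSucc L with hG
  -- the coefficient of a low exponent vanishes at an equimultiple point
  have hcoeff : ∀ {b : Fin 4 → K} {γ : Fin 4 → ℕ}, γ ≠ 0 → (∑ i, γ i) < q →
      IsEquimultiplePoint q S j b (⟨spec f β (evalT L), r, exc⟩ : State K) →
      coeff (expo γ) (PointBlowup.translate b (spec f β (evalT G))) = 0 := by
    intro b γ h0 hdeg heq
    have hz := heq (expo γ) ((not_congr (expo_eq_zero_iff γ)).mpr h0) (by rw [degree_expo]; exact hdeg)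
    rwa [pointTransform, chartTransform_spec] at hz
  intro steps
  induction steps with
  | nil =>
    intro U e h b hb heq hne
    cases e with
    | dead γ =>
      exact absurd (hcoeff (pwitB_low h).1 (pwitB_low h).2 heq) (coeff_ne_zero_of_pwitB f β hβ h hb)
    | child =>
      simp only [pstepsB, Bool.and_eq_true, decide_eq_true_eq] at h
      obtain ⟨hU, hchild⟩ := h
      subst hU
      have hb0 := eq_zero_of_vanish hb
      subst hb0
      exact rWins_step_zero f hrest hβ hG hchild r exc hne
    | free i =>
      simp only [pstepsB, Bool.and_eq_true, decide_eq_true_eq] at h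
      obtain ⟨⟨⟨hU, htf⟩, hchild⟩, hmem⟩ := h
      subst hU
      by_cases hbi : b i = 0
      · have hb0 : b = 0 := by rw [eq_single_of_vanish hb, hbi, Pi.single_zero]
        subst hb0
        exact rWins_step_zero f hrest hβ hG hchild r exc hne
      · set s' := CentreBlowup.step q S j b (⟨spec f β (evalT L), r, exc⟩ : State K) with hs'
        have hF : s'.F = spec f (b i) (evalT (clean4 q (shearL i G))) := by
          rw [hs', DivClock.step_F_eq, chartTransform_spec, ← hG, spec_eq_of_tfree f htf β (b i),
            eq_single_of_vanish hb, Pi.single_eq_same, translate_single_spec, shearAlg_evalT, deletePthPowers_spec]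
        have hw : RWins q localB (⟨spec f (b i) (evalT (clean4 q (shearL i G))), s'.r, s'.exc⟩ : State K) :=
          pwin_of_memRowB f hrest hmem (b i) hbi s'.r s'.exc
        rw [← hF] at hw
        exact hw
    | root γ i ρ =>
      simp only [pstepsB, Bool.and_eq_true, decide_eq_true_eq, Bool.or_eq_true] at h
      obtain ⟨⟨⟨hU, hroot⟩, hchild⟩, hmem⟩ := h
      subst hU
      have hcases : b i = 0 ∨ b i = f ρ := by
        rcases hroot with hr | hr
        · exact coord_cases_of_prootB f β hr hb (hcoeff (prootB_low hr).1 (prootB_low hr).2 heq)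
        · refine coord_cases_of_prootB f β hr hb ?_
          rw [evalT_reverse]
          exact hcoeff (prootB_low hr).1 (prootB_low hr).2 heq
      rcases hcases with hbi | hbi
      · have hb0 : b = 0 := by rw [eq_single_of_vanish hb, hbi, Pi.single_zero]
        subst hb0
        exact rWins_step_zero f hrest hβ hG hchild r exc hne
      · set s' := CentreBlowup.step q S j b (⟨spec f β (evalT L), r, exc⟩ : State K) with hs'
        have hF : s'.F = spec f β (evalT (clean4 q (transVar i.castSucc ρ G))) := by
          rw [hs', DivClock.step_F_eq, chartTransform_spec, ← hG, eq_single_of_vanish hb, hbi,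
            translate_single_map_spec, tau_evalT, deletePthPowers_spec]
        have hw : RWins q localB
            (⟨spec f β (evalT (clean4 q (transVar i.castSucc ρ G))), s'.r, s'.exc⟩ : State K) :=
          pwin_of_memRowB f hrest hmem β hβ s'.r s'.exc
        rw [← hF] at hw
        exact hw
  | cons st steps ih =>
    intro U e h b hb heq hne
    obtain ⟨γ, i⟩ := st
    simp only [pstepsB, Bool.and_eq_true] at h
    obtain ⟨hforce, hsteps⟩ := h
    have hbi : b i = 0 :=
      coord_eq_zero_of_pforceB f β hβ hforce hb (hcoeff (pforceB_low hforce).1 (pforceB_low hforce).2 heq)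
    refine ih (U.erase i) e hsteps b (fun m hm => ?_) heq hne
    by_cases hmi : m = i
    · rw [hmi]; exact hbi
    · exact hb m fun hmU => hm (Finset.mem_erase.mpr ⟨hmi, hmU⟩)

/-- **soundness of one row.** OURS. [folklore] -/
theorem pwin_of_prowB {q : ℕ} {rest : List (PRow k)} (hrest : ∀ row ∈ rest, (∀ β : K, β ≠ 0 → ∀ (r : Fin 4 →₀ ℕ) (exc : Finset (Fin 4)),
      RWins q localB (⟨spec f β (evalT row.1), r, exc⟩ : State K))) {row : PRow k}
    (h : prowB q rest row = true) :
    (∀ β : K, β ≠ 0 → ∀ (r : Fin 4 →₀ ℕ) (exc : Finset (Fin 4)),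
      RWins q localB (⟨spec f β (evalT row.1), r, exc⟩ : State K)) := by
  obtain ⟨L, cert⟩ := row
  intro β hβ r exc
  cases cert with
  | blind c w α₀ a =>
    simp only [prowB, Bool.and_eq_true] at h
    obtain ⟨htf, hblind⟩ := h
    refine Game.Wins.terminal fun _ hS => ?_
    have hns := WinCertAllFields.not_inCoordinateScope_map_of_blindB f hblind
    rw [← spec_eq_map_trunc f β htf] at hns
    exact hns hS.1
  | move S ch =>
    simp only [prowB, Bool.and_eq_true, decide_eq_true_eq] at h
    obtain ⟨hperm, hall⟩ := h
    by_cases hsc : InCoordinateScope q (spec f β (evalT L))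
    · refine Game.Wins.move (m := S) ⟨hsc, isPermissibleCentre_spec f β hperm⟩ ?_
      rintro s' ⟨j, b, hj, hbj, hloc, heq, hne, rfl⟩
      exact rWins_step_of_pstepsB f hrest hβ r exc _ _ _ (hall j hj) b
        (vanish_erase K hbj ((localB_eq_true_iff S j b).mp hloc)) heq hne
    · exact Game.Wins.terminal fun _ hS' => hsc hS'.1

/-- **SOUNDNESS OF PARAMETRIC CERTIFICATES**: every row of a checked table is certified. OURS. [folklore] -/
theorem pwin_of_pcertB {q : ℕ} : ∀ {T : List (PRow k)}, pcertB q T = true → ∀ row ∈ T,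
    (∀ β : K, β ≠ 0 → ∀ (r : Fin 4 →₀ ℕ) (exc : Finset (Fin 4)),
      RWins q localB (⟨spec f β (evalT row.1), r, exc⟩ : State K))
  | [], _ => fun row hrow => absurd hrow List.not_mem_nil
  | row :: rest, h => by
    unfold pcertB at h
    rw [Bool.and_eq_true] at h
    have hrest := pwin_of_pcertB h.2
    intro r hr
    rcases List.mem_cons.mp hr with rfl | hr'
    · exact pwin_of_prowB f hrest h.1
    · exact hrest r hr'

/-- the head row of a checked table is certified. OURS. [folklore] -/
theorem pwin_head_of_pcertB {q : ℕ} {row : PRow k} {rest : List (PRow k)} (h : pcertB q (row :: rest) = true) :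
    (∀ β : K, β ≠ 0 → ∀ (r : Fin 4 →₀ ℕ) (exc : Finset (Fin 4)),
      RWins q localB (⟨spec f β (evalT row.1), r, exc⟩ : State K)) :=
  pwin_of_pcertB f h row List.mem_cons_self

end Sound

/-! ## §3 Entry point for presented `𝔽₃` states -/

/-- **a presented `𝔽₃` state whose embedding heads a checked parametric table is a LOCAL A-win over EVERY field of
characteristic 3.** OURS. [folklore] -/
theorem rWins_liftState_of_pcertB (L : Type) [Field L] [CharP L 3] [DecidableEq L] {s : SData 4 (ZMod 3)}
    {cert : PRowCert (ZMod 3)} {rest : List (PRow (ZMod 3))} (h : pcertB 3 ((embed s.L, cert) :: rest) = true) :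
    RWins 3 localB (liftState L s.toState) := by
  have hw := pwin_head_of_pcertB (φ3 L) h 1 one_ne_zero (expo s.r) s.exc
  rw [spec_embed] at hw
  exact hw

end LoopCLocal

end Summit.ResolutionOfSingularities.ResolutionOfSingularities.Theorems.PIDim4

end
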